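import Literature.MathematicalPhysics.QuantumManyBody.CoarseModeRayPOVM
import Literature.MathematicalPhysics.QuantumManyBody.PeriodicBoseGasMomentumSector
import Literature.MathematicalPhysics.QuantumManyBody.WeightedCorrector
import Literature.Analysis.FunctionSpaces.SmoothParametricSetIntegral
import HarnessLib

/-!
# The coarse-mode ray Kraus map preserves the periodic Bose-symmetric `C¹` form core

Topic `Literature/MathematicalPhysics/QuantumManyBody`, companion of `CoarseModeRayPOVM.lean`
(definition item `defn-CoarseModeRayPOVM`, route `BECIroning` of
`AtomisticToContinuum/BoseEinsteinCondensation`): the structural facts that make the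
record-conditional states `K_zΨ` of an admissible periodic state `Ψ : PeriodicTrialState N L`
again admissible after normalisation, so that the variational principle
`periodicGroundStateEnergy_le` applies to them and to their phase unwindings
(`PeriodicTrialState.phaseMul` of `OneBodyCurrentGain.lean`) — the input of the "ironing"
inequality `GAIN ≤ COST`.

* **Periodicity** (`kernelProj_add_single`, `coarseModeRayPOVM_add_single`,
  `sectorProj_add_single`): the product-kernel operators, `K_z` and `Π_m` commute with the lattice
  translations `X ↦ X + L e_{i,k}` of each particle (the plane-wave kernels are `Lℤ³`-periodic,
  `L ≠ 0`), so they act on functions on the torus.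
* **Bose symmetry** (`kernelProj_comp_perm`, `coarseModeRayPOVM_comp_perm`, `sectorProj_comp_perm`):
  relabelling covariance `(kernelProj L C κ Φ)(X ∘ σ) = (kernelProj L σ(C) (κ ∘ σ⁻¹) Φ)(X)` for
  symmetric `Φ` (change of variables `y = y' ∘ e` in the product measure along
  `e : ↥C ≃ ↥σ(C)`, `MeasureTheory.measurePreserving_piCongrLeft`), and the reindexing
  `A ↦ σ(A)` of the Kraus sum (`|σ(A)| = |A|`).
* **`C¹` regularity** (`contDiff_kernelProj`, `contDiff_coarseModeRayPOVM`, `contDiff_sectorProj`):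
  differentiation under the integral over the bounded `cell^C` for jointly `C¹` kernels and
  `Φ ∈ C¹`, through the general lemmas `contDiff_one_parametric_setIntegral_of_isBounded` and
  `continuous_parametric_setIntegral_of_isBounded` (one derivative under the integral sign,
  `Literature.Analysis.FunctionSpaces.hasFDerivAt_parametric_setIntegral`, plus dominated
  continuity of the derivative; Evans, *PDE*, App. C.4).
* **`PeriodicTrialState.conditionalState Ψ S z h0 = K_zΨ/‖K_zΨ‖`** — the normalised
  record-conditional state as an admissible periodic state whenever the outcome has positive
  weight `∫_{cell}|K_zΨ|² ≠ 0` (`PeriodicTrialState.ofFun`; finiteness of the weight is automatic,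
  `lintegral_cellN_nnnorm_sq_ne_top`).

All statements are proved; the only definitions are the relabelling equivalence
`finsetPermEquiv σ C : ↥C ≃ ↥σ(C)` and `PeriodicTrialState.conditionalState`. Not here: the POVM
identity `∫‖K_zΨ‖² dσ = ‖Ψ‖²` (see `CoarseModeRayPOVM.lean`, §Design choices) and continuity in `z`.

## References

* [LiebSeiringer2006] E. H. Lieb, R. Seiringer, *Derivation of the Gross–Pitaevskii equation for
  rotating Bose gases*, Comm. Math. Phys. 264 (2006) 505–537: Sect. 3, Step 3 (coherent states on
  the coarse modes act within the bosonic space).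
* [BengtssonZyczkowski2017] I. Bengtsson, K. Życzkowski, *Geometry of Quantum States*, 2nd ed.,
  CUP 2017: §10.1 (10.18)–(10.21) (coherent-state POVM, post-measurement states).
-/

noncomputable section

open MeasureTheory Metric
open scoped ENNReal NNReal ComplexConjugate

namespace Literature.MathematicalPhysics.QuantumManyBody.BoseGas

variable {N : ℕ}

/-! ### Periodicity of `K_z Φ` in every particle -/

section Periodicity

variable {L : ℝ} {S : Finset (Fin 3 → ℤ)}

/-- Substituting the coordinates in `C` after translating a particle `i ∉ C` is translating after
substituting. [folklore] -/
theorem updateFinset_add_single_of_notMem {C : Finset (Fin N)} {i : Fin N} (hi : i ∉ C)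
    (X : Config N) (v : Space) (y : ↥C → Space) :
    Function.updateFinset (X + Pi.single i v) C y = Function.updateFinset X C y + Pi.single i v := by
  funext j
  by_cases hj : j ∈ C
  · have hji : j ≠ i := fun h => hi (h ▸ hj)
    simp [Function.updateFinset, hj, hji]
  · simp [Function.updateFinset, hj]

/-- Substituting the coordinates in `C` after translating a particle `i ∈ C` forgets the
translation. [folklore] -/
theorem updateFinset_add_single_of_mem {C : Finset (Fin N)} {i : Fin N} (hi : i ∈ C)
    (X : Config N) (v : Space) (y : ↥C → Space) :
    Function.updateFinset (X + Pi.single i v) C y = Function.updateFinset X C y := by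
  funext j
  by_cases hj : j ∈ C
  · simp [Function.updateFinset, hj]
  · have hji : j ≠ i := fun h => hj (h ▸ hi)
    simp [Function.updateFinset, hj, hji]

/-- **Periodicity of the product-kernel operators**: if every kernel `κⱼ(·, y)` and `Φ` are
`v`-periodic in the particle `i`, so is `kernelProj L C κ Φ` (for `i ∉ C` only the periodicity of
`Φ` is used, for `i ∈ C` only that of `κᵢ`). [folklore] -/
theorem kernelProj_add_single (L : ℝ) (C : Finset (Fin N)) {κ : Fin N → Space → Space → ℂ}
    {Φ : Config N → ℂ} {i : Fin N} {v : Space} (hκ : ∀ x y, κ i (x + v) y = κ i x y)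
    (hΦ : ∀ X, Φ (X + Pi.single i v) = Φ X) (X : Config N) :
    kernelProj L C κ Φ (X + Pi.single i v) = kernelProj L C κ Φ X := by
  unfold kernelProj
  congr 1
  funext y
  by_cases hi : i ∈ C
  · rw [updateFinset_add_single_of_mem hi]
    congr 1
    refine Finset.prod_congr rfl fun j _ => ?_
    by_cases hji : (j : Fin N) = i
    · rw [Pi.add_apply, hji, Pi.single_eq_same, hκ]
    · rw [Pi.add_apply, Pi.single_eq_of_ne hji, add_zero]
  · rw [updateFinset_add_single_of_notMem hi, hΦ]
    congr 1
    refine Finset.prod_congr rfl fun j _ => ?_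
    have hji : (j : Fin N) ≠ i := fun h => hi (h ▸ j.2)
    rw [Pi.add_apply, Pi.single_eq_of_ne hji, add_zero]

/-- The plane-wave kernels are `Lℤ³`-periodic in the first variable. [folklore] -/
theorem coarseKernel_add_single (hL : L ≠ 0) (S : Finset (Fin 3 → ℤ)) (x y : Space) (k : Fin 3) :
    coarseKernel L S (x + EuclideanSpace.single k L) y = coarseKernel L S x y := by
  simp only [coarseKernel, planeWaveMode_periodic hL]

/-- The ray mode is `Lℤ³`-periodic. [folklore] -/
theorem rayMode_add_single (hL : L ≠ 0) (S : Finset (Fin 3 → ℤ)) (z : EuclideanSpace ℂ ↥S)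
    (x : Space) (k : Fin 3) : rayMode L S z (x + EuclideanSpace.single k L) = rayMode L S z x := by
  simp only [rayMode, planeWaveMode_periodic hL]

/-- The ray kernel is `Lℤ³`-periodic in the first variable. [folklore] -/
theorem rayKernel_add_single (hL : L ≠ 0) (S : Finset (Fin 3 → ℤ)) (z : EuclideanSpace ℂ ↥S)
    (x y : Space) (k : Fin 3) :
    rayKernel L S z (x + EuclideanSpace.single k L) y = rayKernel L S z x y := by
  rw [rayKernel, rayKernel, rayMode_add_single hL]

/-- **`K_z Φ` is periodic in every particle** when `Φ` is (`L ≠ 0`): the Kraus map acts on functions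
on the torus. [cite: LiebSeiringer2006, Sect. 3 Step 3] -/
theorem coarseModeRayPOVM_add_single (hL : L ≠ 0) (S : Finset (Fin 3 → ℤ)) (z : EuclideanSpace ℂ ↥S)
    {Φ : Config N → ℂ}
    (hΦ : ∀ (X : Config N) (i : Fin N) (k : Fin 3), Φ (X + Pi.single i (EuclideanSpace.single k L)) = Φ X)
    (X : Config N) (i : Fin N) (k : Fin 3) :
    coarseModeRayPOVM L S z Φ (X + Pi.single i (EuclideanSpace.single k L)) =
      coarseModeRayPOVM L S z Φ X := by
  simp only [coarseModeRayPOVM, rayKrausTerm]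
  refine Finset.sum_congr rfl fun A _ => ?_
  congr 1
  refine Finset.sum_congr rfl fun B _ => ?_
  congr 1
  refine kernelProj_add_single L (A ∪ B) (fun x y => ?_) (fun Y => hΦ Y i k) X
  by_cases hiA : i ∈ A
  · simp only [hiA, if_true, rayKernel_add_single hL]
  · simp only [hiA, if_false, coarseKernel_add_single hL]

/-- **`Π_m Φ` is periodic in every particle** when `Φ` is (`L ≠ 0`). [cite: LiebSeiringer2006, Sect. 3 Step 3] -/
theorem sectorProj_add_single (hL : L ≠ 0) (S : Finset (Fin 3 → ℤ)) (m : ℕ) {Φ : Config N → ℂ}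
    (hΦ : ∀ (X : Config N) (i : Fin N) (k : Fin 3), Φ (X + Pi.single i (EuclideanSpace.single k L)) = Φ X)
    (X : Config N) (i : Fin N) (k : Fin 3) :
    sectorProj L S m Φ (X + Pi.single i (EuclideanSpace.single k L)) = sectorProj L S m Φ X := by
  simp only [sectorProj]
  refine Finset.sum_congr rfl fun A _ => Finset.sum_congr rfl fun B _ => ?_
  rw [kernelProj_add_single L (A ∪ B) (fun x y => coarseKernel_add_single hL S x y k)
    (fun Y => hΦ Y i k) X]

end Periodicity

/-! ### Bose symmetry of `K_z Φ` -/

section Symmetry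

variable {L : ℝ} {S : Finset (Fin 3 → ℤ)}

/-- Relabelling the particles: the set `C` seen through the permutation `σ`, `↥C ≃ ↥(σ(C))`.
[folklore] -/
def finsetPermEquiv (σ : Equiv.Perm (Fin N)) (C : Finset (Fin N)) : ↥C ≃ ↥(C.map σ.toEmbedding) :=
  σ.subtypeEquiv fun _ => (Finset.mem_map' σ.toEmbedding).symm

/-- Unfolding: the relabelling equivalence is `σ` on the underlying indices. [folklore] -/
@[simp]
theorem coe_finsetPermEquiv (σ : Equiv.Perm (Fin N)) (C : Finset (Fin N)) (j : ↥C) :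
    (finsetPermEquiv σ C j : Fin N) = σ j := rfl

/-- Substitution commutes with relabelling:
`(X ∘ σ)[C := y' ∘ e] = (X[σ(C) := y']) ∘ σ` for the relabelling `e : ↥C ≃ ↥σ(C)`. [folklore] -/
theorem updateFinset_comp_perm (σ : Equiv.Perm (Fin N)) (C : Finset (Fin N)) (X : Config N)
    (y' : ↥(C.map σ.toEmbedding) → Space) :
    Function.updateFinset (X ∘ σ) C (fun j => y' (finsetPermEquiv σ C j)) =
      Function.updateFinset X (C.map σ.toEmbedding) y' ∘ σ := by
  funext j
  by_cases hj : j ∈ C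
  · have hj' : σ j ∈ C.map σ.toEmbedding := (Finset.mem_map' σ.toEmbedding).mpr hj
    simp only [Function.comp_apply, Function.updateFinset, hj, hj', dif_pos]
    rfl
  · have hj' : σ j ∉ C.map σ.toEmbedding := fun h => hj ((Finset.mem_map' σ.toEmbedding).mp h)
    simp only [Function.comp_apply, Function.updateFinset, hj, hj', dif_neg, not_false_eq_true]

/-- **Relabelling covariance of the product-kernel operators**: for Bose-symmetric `Φ`,
`(kernelProj L C κ Φ)(X ∘ σ) = (kernelProj L σ(C) (κ ∘ σ⁻¹) Φ)(X)` (change of variables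
`y = y' ∘ e` in the product measure, `MeasureTheory.measurePreserving_piCongrLeft`). [folklore] -/
theorem kernelProj_comp_perm (L : ℝ) (C : Finset (Fin N)) (κ : Fin N → Space → Space → ℂ)
    {Φ : Config N → ℂ} (hΦ : ∀ (τ : Equiv.Perm (Fin N)) (X : Config N), Φ (X ∘ τ) = Φ X)
    (σ : Equiv.Perm (Fin N)) (X : Config N) :
    kernelProj L C κ Φ (X ∘ σ) =
      kernelProj L (C.map σ.toEmbedding) (fun j => κ (σ.symm j)) Φ X := by
  unfold kernelProj
  have hmp := (measurePreserving_piCongrLeft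
    (fun _ : ↥(C.map σ.toEmbedding) => (volume : Measure Space).restrict (cell L))
    (finsetPermEquiv σ C)).symm _
  rw [← hmp.integral_comp']
  congr 1
  funext y'
  have hy : ((MeasurableEquiv.piCongrLeft (fun _ : ↥(C.map σ.toEmbedding) => Space)
      (finsetPermEquiv σ C)).symm y' : ↥C → Space) = fun j => y' (finsetPermEquiv σ C j) :=
    funext fun _ => rfl
  rw [hy, updateFinset_comp_perm σ C X y', hΦ σ]
  congr 1
  exact Fintype.prod_equiv (finsetPermEquiv σ C) _ _ fun j => by simp

/-- **`K_z Φ` is Bose-symmetric** when `Φ` is: the Kraus map commutes with relabelling of the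
particles (the sum over `A` is reindexed by `A ↦ σ(A)`, `|σ(A)| = |A|`). [cite: LiebSeiringer2006, Sect. 3 Step 3] -/
theorem coarseModeRayPOVM_comp_perm (L : ℝ) (S : Finset (Fin 3 → ℤ)) (z : EuclideanSpace ℂ ↥S)
    {Φ : Config N → ℂ} (hΦ : ∀ (τ : Equiv.Perm (Fin N)) (X : Config N), Φ (X ∘ τ) = Φ X)
    (σ : Equiv.Perm (Fin N)) (X : Config N) :
    coarseModeRayPOVM L S z Φ (X ∘ σ) = coarseModeRayPOVM L S z Φ X := by
  simp only [coarseModeRayPOVM, rayKrausTerm]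
  refine Fintype.sum_equiv (Equiv.finsetCongr σ) _ _ fun A => ?_
  rw [Equiv.finsetCongr_apply, Finset.card_map]
  congr 1
  refine Finset.sum_equiv (Equiv.finsetCongr σ) (fun B => ?_) (fun B _ => ?_)
  · rw [Equiv.finsetCongr_apply, Finset.mem_powerset, Finset.mem_powerset]
    rw [le_compl_iff_disjoint_right, le_compl_iff_disjoint_right, Finset.disjoint_map]
  · rw [Equiv.finsetCongr_apply, Finset.card_map, kernelProj_comp_perm L (A ∪ B) _ hΦ σ X,
      Finset.map_union]
    congr 2
    funext j
    simp only [Finset.mem_map_equiv]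

/-- **`Π_m Φ` is Bose-symmetric** when `Φ` is (relabelling `A ↦ σ(A)` preserves `|A| = m`).
[cite: LiebSeiringer2006, Sect. 3 Step 3] -/
theorem sectorProj_comp_perm (L : ℝ) (S : Finset (Fin 3 → ℤ)) (m : ℕ) {Φ : Config N → ℂ}
    (hΦ : ∀ (τ : Equiv.Perm (Fin N)) (X : Config N), Φ (X ∘ τ) = Φ X)
    (σ : Equiv.Perm (Fin N)) (X : Config N) :
    sectorProj L S m Φ (X ∘ σ) = sectorProj L S m Φ X := by
  simp only [sectorProj]
  refine Finset.sum_equiv (Equiv.finsetCongr σ) (fun A => ?_) (fun A _ => ?_)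
  · simp only [Equiv.finsetCongr_apply, Finset.mem_powersetCard, Finset.card_map,
      Finset.subset_univ, true_and]
  · refine Finset.sum_equiv (Equiv.finsetCongr σ) (fun B => ?_) (fun B _ => ?_)
    · rw [Equiv.finsetCongr_apply, Equiv.finsetCongr_apply, Finset.mem_powerset,
        Finset.mem_powerset, le_compl_iff_disjoint_right, le_compl_iff_disjoint_right,
        Finset.disjoint_map]
    · rw [Equiv.finsetCongr_apply, Equiv.finsetCongr_apply, Finset.card_map,
        kernelProj_comp_perm L (A ∪ B) _ hΦ σ X, Finset.map_union]

end Symmetry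

/-! ### `K_z Φ` is `C¹` for `Φ ∈ C¹` (differentiation under the integral sign) -/

section Regularity

variable {L : ℝ} {S : Finset (Fin 3 → ℤ)}

/-- **Continuity of parametric integrals over a bounded set** (dominated convergence with the
constant bound given by compactness of `closure K × closedBall p₀ 1`): for continuous
`G : Y × P → F` and bounded measurable `K ⊆ Y`, `p ↦ ∫_{K} G(y, p) dμ(y)` is continuous.
[folklore] -/
theorem continuous_parametric_setIntegral_of_isBounded {Y : Type*} [NormedAddCommGroup Y]
    [NormedSpace ℝ Y] [FiniteDimensional ℝ Y] [MeasurableSpace Y] [BorelSpace Y]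
    {P : Type*} [NormedAddCommGroup P] [NormedSpace ℝ P] [FiniteDimensional ℝ P]
    {F : Type*} [NormedAddCommGroup F] [NormedSpace ℝ F] {μ : Measure Y}
    [IsFiniteMeasureOnCompacts μ] {K : Set Y} (hK : Bornology.IsBounded K) (hKm : MeasurableSet K)
    {G : Y × P → F} (hG : Continuous G) : Continuous fun p : P => ∫ y in K, G (y, p) ∂μ := by
  rw [continuous_iff_continuousAt]
  intro p₀
  obtain ⟨C, hC⟩ : ∃ C, ∀ q ∈ closure K ×ˢ closedBall p₀ 1, ‖G q‖ ≤ C := by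
    have hK' : IsCompact (closure K ×ˢ closedBall p₀ (1 : ℝ)) :=
      hK.isCompact_closure.prod (isCompact_closedBall p₀ 1)
    obtain ⟨C, hC⟩ := hK'.exists_bound_of_continuousOn hG.continuousOn
    exact ⟨C, hC⟩
  have hμK : μ K ≠ ⊤ :=
    ((measure_mono subset_closure).trans_lt hK.isCompact_closure.measure_lt_top).ne
  refine continuousAt_of_dominated (bound := fun _ => C) ?_ ?_ ?_ ?_
  · exact Filter.Eventually.of_forall fun p =>
      (hG.comp (continuous_id.prodMk continuous_const)).aestronglyMeasurable
  · filter_upwards [closedBall_mem_nhds p₀ one_pos] with p hp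
    rw [ae_restrict_iff' hKm]
    exact Filter.Eventually.of_forall fun y hy => hC (y, p) ⟨subset_closure hy, hp⟩
  · exact integrableOn_const (hs := hμK)
  · exact Filter.Eventually.of_forall fun y =>
      (hG.comp (continuous_const.prodMk continuous_id)).continuousAt

/-- **`C¹` dependence of parametric integrals over a bounded set on the parameter**: for
`H : Y × P → F` of class `C¹` and bounded measurable `K ⊆ Y`, `p ↦ ∫_K H(y, p) dμ(y)` is `C¹`
(one derivative under the integral sign, `hasFDerivAt_parametric_setIntegral` of
`Literature.Analysis.FunctionSpaces`, plus continuity of the derivative, which is again a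
parametric integral of a continuous function). [folklore] -/
theorem contDiff_one_parametric_setIntegral_of_isBounded {Y : Type*} [NormedAddCommGroup Y]
    [NormedSpace ℝ Y] [FiniteDimensional ℝ Y] [MeasurableSpace Y] [BorelSpace Y]
    {P : Type*} [NormedAddCommGroup P] [NormedSpace ℝ P] [FiniteDimensional ℝ P]
    {F : Type*} [NormedAddCommGroup F] [NormedSpace ℝ F] [CompleteSpace F] {μ : Measure Y}
    [IsFiniteMeasureOnCompacts μ] {K : Set Y} (hK : Bornology.IsBounded K) (hKm : MeasurableSet K)
    {H : Y × P → F} (hH : ContDiff ℝ 1 H) : ContDiff ℝ 1 fun p : P => ∫ y in K, H (y, p) ∂μ := by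
  have hd := fun p => Literature.Analysis.FunctionSpaces.hasFDerivAt_parametric_setIntegral
    (μ := μ) hK hKm hH one_ne_zero p
  rw [contDiff_one_iff_fderiv]
  refine ⟨fun p => (hd p).differentiableAt, ?_⟩
  have hfd : fderiv ℝ (fun p : P => ∫ y in K, H (y, p) ∂μ) = fun p =>
      ∫ y in K, (fderiv ℝ H (y, p)).comp (ContinuousLinearMap.inr ℝ Y P) ∂μ :=
    funext fun p => (hd p).fderiv
  rw [hfd]
  have hc : Continuous fun q : Y × P => (fderiv ℝ H q).comp (ContinuousLinearMap.inr ℝ Y P) :=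
    (hH.continuous_fderiv one_ne_zero).clm_comp continuous_const
  exact continuous_parametric_setIntegral_of_isBounded hK hKm hc

/-- The fundamental cell is bounded. [folklore] -/
theorem isBounded_cell (L : ℝ) : Bornology.IsBounded (cell L) :=
  (isCompact_closedBox L).isBounded.subset (cell_subset_closedBox L)

/-- Substitution `(y, X) ↦ X[C := y]` is a smooth (linear) map. [folklore] -/
theorem contDiff_updateFinset (C : Finset (Fin N)) :
    ContDiff ℝ (⊤ : ℕ∞) fun q : (↥C → Space) × Config N => Function.updateFinset q.2 C q.1 := by
  rw [contDiff_pi]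
  intro j
  by_cases hj : j ∈ C
  · have h : (fun q : (↥C → Space) × Config N => Function.updateFinset q.2 C q.1 j) =
        fun q => q.1 ⟨j, hj⟩ := by
      funext q; simp [Function.updateFinset, hj]
    rw [h]
    exact (contDiff_apply ℝ Space (⟨j, hj⟩ : ↥C)).comp contDiff_fst
  · have h : (fun q : (↥C → Space) × Config N => Function.updateFinset q.2 C q.1 j) =
        fun q => q.2 j := by
      funext q; simp [Function.updateFinset, hj]
    rw [h]
    exact (contDiff_apply ℝ Space j).comp contDiff_snd

/-- **The product-kernel operators preserve `C¹`**: if every kernel `κᵢ` is jointly `C¹` and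
`Φ ∈ C¹`, then `kernelProj L C κ Φ ∈ C¹` (differentiation under the integral over the bounded
`cell^C`). [folklore] -/
theorem contDiff_kernelProj (L : ℝ) (C : Finset (Fin N)) {κ : Fin N → Space → Space → ℂ}
    (hκ : ∀ i, ContDiff ℝ 1 fun q : Space × Space => κ i q.1 q.2) {Φ : Config N → ℂ}
    (hΦ : ContDiff ℝ 1 Φ) : ContDiff ℝ 1 (kernelProj L C κ Φ) := by
  set K : Set (↥C → Space) := Set.univ.pi fun _ : ↥C => cell L with hK
  set H : (↥C → Space) × Config N → ℂ := fun q =>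
    (∏ i : ↥C, κ i (q.2 i) (q.1 i)) * Φ (Function.updateFinset q.2 C q.1) with hH
  have hrepr : kernelProj L C κ Φ = fun X => ∫ y in K, H (y, X) := by
    funext X
    rw [kernelProj, hK, ← Measure.restrict_pi_pi, ← volume_pi]
  rw [hrepr]
  have hHC : ContDiff ℝ 1 H := by
    refine ContDiff.mul (contDiff_prod fun i _ => ?_)
      (hΦ.comp ((contDiff_updateFinset C).of_le (mod_cast le_top)))
    have h1 : ContDiff ℝ 1 fun q : (↥C → Space) × Config N => (q.2 (i : Fin N), q.1 i) :=
      (((contDiff_apply ℝ Space (i : Fin N)).comp contDiff_snd).prodMk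
        ((contDiff_apply ℝ Space i).comp contDiff_fst)).of_le le_top
    exact (hκ i).comp h1
  exact contDiff_one_parametric_setIntegral_of_isBounded
    (Bornology.IsBounded.pi fun _ => isBounded_cell L)
    (MeasurableSet.univ_pi fun _ => measurableSet_cell L) hHC

/-- The coarse kernel is jointly smooth. [folklore] -/
theorem contDiff_coarseKernel (L : ℝ) (S : Finset (Fin 3 → ℤ)) :
    ContDiff ℝ 1 fun q : Space × Space => coarseKernel L S q.1 q.2 := by
  unfold coarseKernel
  refine ContDiff.sum fun n _ => ?_
  have hn : ContDiff ℝ 1 (planeWaveMode L n) := (contDiff_planeWaveMode L n).of_le (mod_cast le_top)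
  exact (hn.comp contDiff_fst).mul (Complex.conjCLE.contDiff.comp (hn.comp contDiff_snd))

/-- The ray mode is smooth. [folklore] -/
theorem contDiff_rayMode (L : ℝ) (S : Finset (Fin 3 → ℤ)) (z : EuclideanSpace ℂ ↥S) :
    ContDiff ℝ 1 (rayMode L S z) := by
  unfold rayMode
  exact ContDiff.sum fun n _ => contDiff_const.mul
    ((contDiff_planeWaveMode L _).of_le (mod_cast le_top))

/-- The ray kernel is jointly smooth. [folklore] -/
theorem contDiff_rayKernel (L : ℝ) (S : Finset (Fin 3 → ℤ)) (z : EuclideanSpace ℂ ↥S) :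
    ContDiff ℝ 1 fun q : Space × Space => rayKernel L S z q.1 q.2 := by
  unfold rayKernel
  exact ((contDiff_rayMode L S z).comp contDiff_fst).mul
    (Complex.conjCLE.contDiff.comp ((contDiff_rayMode L S z).comp contDiff_snd))

/-- **`K_z Φ ∈ C¹` for `Φ ∈ C¹`.** Together with `coarseModeRayPOVM_add_single` and
`coarseModeRayPOVM_comp_perm`: `K_z` maps the periodic, Bose-symmetric `C¹` functions (the form
core underlying `PeriodicTrialState`) into themselves. [cite: LiebSeiringer2006, Sect. 3 Step 3] -/
theorem contDiff_coarseModeRayPOVM (L : ℝ) (S : Finset (Fin 3 → ℤ)) (z : EuclideanSpace ℂ ↥S)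
    {Φ : Config N → ℂ} (hΦ : ContDiff ℝ 1 Φ) : ContDiff ℝ 1 (coarseModeRayPOVM L S z Φ) := by
  have h : coarseModeRayPOVM L S z Φ = fun X => ∑ A : Finset (Fin N),
      (Real.sqrt (symDim S.card A.card) : ℂ) * ∑ B ∈ Aᶜ.powerset, (-1 : ℂ) ^ B.card *
        kernelProj L (A ∪ B) (fun i => if i ∈ A then rayKernel L S z else coarseKernel L S) Φ X := by
    funext X; rfl
  rw [h]
  refine ContDiff.sum fun A _ => contDiff_const.mul (ContDiff.sum fun B _ => contDiff_const.mul ?_)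
  refine contDiff_kernelProj L (A ∪ B) (fun i => ?_) hΦ
  by_cases hiA : i ∈ A
  · simp only [hiA, if_true]
    exact contDiff_rayKernel L S z
  · simp only [hiA, if_false]
    exact contDiff_coarseKernel L S

/-- **`Π_m Φ ∈ C¹` for `Φ ∈ C¹`.** [cite: LiebSeiringer2006, Sect. 3 Step 3] -/
theorem contDiff_sectorProj (L : ℝ) (S : Finset (Fin 3 → ℤ)) (m : ℕ) {Φ : Config N → ℂ}
    (hΦ : ContDiff ℝ 1 Φ) : ContDiff ℝ 1 (sectorProj L S m Φ) := by
  have h : sectorProj L S m Φ = fun X => ∑ A ∈ (Finset.univ : Finset (Fin N)).powersetCard m,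
      ∑ B ∈ Aᶜ.powerset, (-1 : ℂ) ^ B.card * kernelProj L (A ∪ B) (fun _ => coarseKernel L S) Φ X := by
    funext X; rfl
  rw [h]
  exact ContDiff.sum fun A _ => ContDiff.sum fun B _ => contDiff_const.mul
    (contDiff_kernelProj L (A ∪ B) (fun _ => contDiff_coarseKernel L S) hΦ)

end Regularity

/-! ### The normalised record-conditional state -/

section ConditionalState

variable {L : ℝ} {S : Finset (Fin 3 → ℤ)}

/-- A continuous function has finite `L²` mass on the fundamental cell. [folklore] -/
theorem lintegral_cellN_nnnorm_sq_ne_top {Φ : Config N → ℂ} (hΦ : Continuous Φ) (L : ℝ) :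
    ∫⁻ X in cellN N L, (‖Φ X‖₊ : ℝ≥0∞) ^ 2 ≠ ⊤ := by
  have hint : IntegrableOn (fun X => ‖Φ X‖ ^ 2) (cellN N L) volume :=
    integrableOn_cellN ((hΦ.norm).pow 2) L
  have h := hint.hasFiniteIntegral
  rw [HasFiniteIntegral] at h
  refine ne_of_lt (lt_of_le_of_lt (le_of_eq (lintegral_congr fun X => ?_)) h)
  rw [coe_nnnorm_sq_eq_ofReal, Real.enorm_eq_ofReal (sq_nonneg _)]

/-- An admissible state with at least one particle lives on a box of positive side. [folklore] -/
theorem PeriodicTrialState.sideLength_ne_zero (Ψ : PeriodicTrialState N L) (i : Fin N) : L ≠ 0 :=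
  fun h => (PeriodicTrialState.isEmpty_of_nonpos h.le (Fin.pos i)).false Ψ

/-- **The record-conditional state** `Ψ_z = K_zΨ/‖K_zΨ‖` of an admissible periodic state `Ψ`
after the coarse-mode ray measurement with outcome `z`, as an admissible periodic state (it is
`C¹`, periodic and Bose-symmetric by `contDiff_coarseModeRayPOVM`, `coarseModeRayPOVM_add_single`,
`coarseModeRayPOVM_comp_perm`), defined whenever the outcome has positive weight
`‖K_zΨ‖² ≠ 0`; the variational principle `E₀ ≤ ⟨U_θΨ_z, H U_θΨ_z⟩` for these states and their
unwindings `(Ψ_z).phaseMul` is the "ironing" inequality's input. [cite: BengtssonZyczkowski2017, §10.1 (10.18)] -/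
def PeriodicTrialState.conditionalState (Ψ : PeriodicTrialState N L) (S : Finset (Fin 3 → ℤ))
    (z : EuclideanSpace ℂ ↥S)
    (h0 : ∫⁻ X in cellN N L, (‖coarseModeRayPOVM L S z Ψ.ψ X‖₊ : ℝ≥0∞) ^ 2 ≠ 0) :
    PeriodicTrialState N L :=
  PeriodicTrialState.ofFun (coarseModeRayPOVM L S z Ψ.ψ)
    (contDiff_coarseModeRayPOVM L S z Ψ.contDiff)
    (fun X i k => coarseModeRayPOVM_add_single (Ψ.sideLength_ne_zero i) S z Ψ.periodic X i k)
    (coarseModeRayPOVM_comp_perm L S z Ψ.symm) h0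
    (lintegral_cellN_nnnorm_sq_ne_top (contDiff_coarseModeRayPOVM L S z Ψ.contDiff).continuous L)

/-- Unfolding: `(Ψ_z).ψ = ‖K_zΨ‖⁻¹ · K_zΨ` with `‖K_zΨ‖² = ∫_{cell} |K_zΨ|²`. [folklore] -/
theorem PeriodicTrialState.conditionalState_ψ (Ψ : PeriodicTrialState N L) (S : Finset (Fin 3 → ℤ))
    (z : EuclideanSpace ℂ ↥S)
    (h0 : ∫⁻ X in cellN N L, (‖coarseModeRayPOVM L S z Ψ.ψ X‖₊ : ℝ≥0∞) ^ 2 ≠ 0) (X : Config N) :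
    (Ψ.conditionalState S z h0).ψ X =
      ((Real.sqrt (∫⁻ Y in cellN N L,
        (‖coarseModeRayPOVM L S z Ψ.ψ Y‖₊ : ℝ≥0∞) ^ 2).toReal)⁻¹ : ℂ) *
        coarseModeRayPOVM L S z Ψ.ψ X :=
  rfl

end ConditionalState

end Literature.MathematicalPhysics.QuantumManyBody.BoseGas
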